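import Summits.SmoothPoincare4.SmoothPoincare4.Theorems.ConvexBisectionAcyclicBisectionExistsBeltFibreFraming
import Summits.SmoothPoincare4.SmoothPoincare4.Theorems.ConvexBisectionAcyclicBisectionExistsBeltFramingFamilies
import Summits.SmoothPoincare4.SmoothPoincare4.Theorems.ConvexBisectionAcyclicBisectionExistsBeltSegmentFraming
import HarnessLib

/-!
# The framed `r`-longitude of an attaching circle, IV: the end framing of the belt slide is homotopic
# to the one-twist fibre framing (stage (3a) of node T3c-1)
(node T3c-1 `node_belt_isotopic_pushoff` of the sub-goal T3 of stub `stub_steinRealisation` (NF6), line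
`modp-braid-orbits`, crux `ConvexBisection.AcyclicBisectionExists`, item stmt-SmoothPoincare4-10508;
wave 3, worker Z5, lead c5)

**Stage (3a), framing clean-up.**  After the slide (`helper_belt_slide`, `helper_belt_slideFramingVector`)
the framed belt knot of handle `i` of a multi-attachment `D` is the framed knot
`(θ ↦ jA (h̄ᵢ (y θ)), θ ↦ d(jA) (dh̄ᵢ (Dι⁻¹ W(θ))))` of `∂P`, `y θ = tubeLongitudePt b r θ`, `W = frameW`.
Here this framing is shown `FramingHomotopic` to the push-forward `d(jA)` of the ONE-TWIST FIBRE FRAMING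
`tubeFibreFraming h̄ᵢ (uDir b θ) (r θ) θ²` — the velocity of `ε ↦ h̄ᵢ (depthLine (uDir b θ) (r θ + ε θ²) 0)`,
i.e. of the fibre arc of the sphere coordinates in the direction `θ²` (`…BeltFibreFraming.lean`):

* §1 continuity into `TP` of `jA`-pushed velocity fields of families off the cores near `ε = 0`
  (`continuous_mk_mfderiv_jA_family_of_mem`);
* §2 **`framingHomotopic_slideEnd_fibre`**: by `…BeltSegmentFraming.lean` (`W ≡ c θ₀ X_θ + (θ₁/c) X_{iθ}`,
  `X_{θ²} = θ₀ X_θ + θ₁ X_{iθ}` modulo the velocity; segments of nowhere-tangent fields are framing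
  homotopies) it suffices to check continuity, tangency and the transversality of the segment, read in
  `ℝ⁴` through the injective `d(jA) ∘ dh̄ᵢ ∘ Dι⁻¹`;
* §3 registered helper `helper_belt_slideFraming_homotopic`.

Everything is proved; no named facts.

## References
* A. A. Kosinski, *Differential Manifolds*, Academic Press (1993), VI §6. [Kosinski1993]
* R. C. Kirby, *The Topology of 4-Manifolds*, LNM 1374 (1989), Ch. I §2 (framings). [Kirby1989]
* R. E. Gompf, *Handlebody construction of Stein surfaces*, Ann. of Math. 148 (1998), §1. [Gompf1998]
-/

noncomputable section

-- the prescribed namespace `Summit.<P>.<Sub>.…` duplicates `SmoothPoincare4` (P = Sub)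
set_option linter.dupNamespace false

open scoped Manifold ContDiff Topology RealInnerProductSpace
open Set Function Metric Real Bundle

namespace Summit.SmoothPoincare4.SmoothPoincare4.Theorems.AcyclicBisectionExists.ModpBraidOrbits

open Literature.Topology.FourManifolds Literature.Topology.FourManifolds.HandleAttachingMap
  Literature.Geometry.Symplectic

/-! ### §1 Pushed velocity fields of families off the cores near `ε = 0` -/

section Family

variable {ι : Type*} [Finite ι] {M : Type*} [TopologicalSpace M] [T2Space M]
  [ChartedSpace (EuclideanHalfSpace 4) M] [IsManifold (𝓡∂ 4) ∞ M] {h : ι → HandleAttachingMap 3 2 M}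
  {P : Type*} [TopologicalSpace P] [ChartedSpace (EuclideanHalfSpace 4) P] [IsManifold (𝓡∂ 4) ∞ P]
  (D : MultiAttachmentData h (𝓡∂ 4) P)

/-- **Velocity fields of families pushed through `jA`, the family being off the cores only on the open
set**: for `G : X × ℝ → M` smooth on an open `O ⊇ X × {0}` with `G(O) ⊆ M ∖ ⋃ cores`, the field
`x ↦ (jA (G (x,0)), d(jA) (d/dε|₀ G (x, ε)))` is continuous into `TP`. [folklore] -/
theorem continuous_mk_mfderiv_jA_family_of_mem {EX HX : Type*} [NormedAddCommGroup EX] [NormedSpace ℝ EX]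
    [TopologicalSpace HX] {IX : ModelWithCorners ℝ EX HX} {X : Type*} [TopologicalSpace X] [ChartedSpace HX X]
    [IsManifold IX ∞ X] (G : X × ℝ → M) {O : Set (X × ℝ)} (hO : IsOpen O) (h0 : ∀ x, ((x, (0 : ℝ)) : X × ℝ) ∈ O)
    (hG : ContMDiffOn (IX.prod 𝓘(ℝ, ℝ)) (𝓡∂ 4) ∞ G O) (hGc : ∀ q ∈ O, G q ∈ coresComplement h) :
    Continuous fun x : X => (TotalSpace.mk' (EuclideanSpace ℝ (Fin 4)) (D.jA ⟨G (x, 0), hGc _ (h0 x)⟩)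
      (mfderiv (𝓡∂ 4) (𝓡∂ 4) D.jA ⟨G (x, 0), hGc _ (h0 x)⟩
        (mfderiv 𝓘(ℝ, ℝ) (𝓡∂ 4) (fun ε : ℝ => G (x, ε)) 0 (1 : ℝ))) : TangentBundle (𝓡∂ 4) P) := by
  rcases isEmpty_or_nonempty X with hX | hX
  · exact continuous_of_discreteTopology
  obtain ⟨x₀⟩ := hX
  classical
  -- the modified family, off the cores everywhere and equal to `G` on `O`
  set G' : X × ℝ → M := fun q => if q ∈ O then G q else G (x₀, 0) with hG'
  have hG'O : ∀ q ∈ O, G' q = G q := fun q hq => by simp [hG', hq]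
  have hG'c : ∀ q, G' q ∈ coresComplement h := fun q => by
    by_cases hq : q ∈ O
    · rw [hG'O q hq]; exact hGc q hq
    · simp only [hG', hq, if_false]; exact hGc _ (h0 x₀)
  have hG's : ContMDiffOn (IX.prod 𝓘(ℝ, ℝ)) (𝓡∂ 4) ∞ G' O := hG.congr hG'O
  have hc := continuous_mk_mfderiv_jA_family D G' hO h0 hG's hG'c
  refine hc.congr fun x => ?_
  -- the velocities agree: `G' (x, ·) = G (x, ·)` near `0`
  have hev : (fun ε : ℝ => G' (x, ε)) =ᶠ[𝓝 0] fun ε : ℝ => G (x, ε) := by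
    have hc2 : Continuous fun ε : ℝ => ((x, ε) : X × ℝ) := by fun_prop
    filter_upwards [hc2.continuousAt.preimage_mem_nhds (hO.mem_nhds (h0 x))] with ε hε
    exact hG'O _ hε
  have hpt : G' (x, 0) = G (x, 0) := hG'O _ (h0 x)
  have hv : mfderiv 𝓘(ℝ, ℝ) (𝓡∂ 4) (fun ε : ℝ => G' (x, ε)) 0 = mfderiv 𝓘(ℝ, ℝ) (𝓡∂ 4) (fun ε : ℝ => G (x, ε)) 0 :=
    hev.mfderiv_eq
  -- rewrite base point and vector together
  have key : ∀ (p : M) (hp : p ∈ coresComplement h) (e : p = G (x, 0))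
      (L : ℝ →L[ℝ] EuclideanSpace ℝ (Fin 4))
      (_ : L = mfderiv 𝓘(ℝ, ℝ) (𝓡∂ 4) (fun ε : ℝ => G (x, ε)) 0),
      (TotalSpace.mk' (EuclideanSpace ℝ (Fin 4)) (D.jA ⟨p, hp⟩) (mfderiv (𝓡∂ 4) (𝓡∂ 4) D.jA ⟨p, hp⟩ (L 1)) :
        TangentBundle (𝓡∂ 4) P) =
      TotalSpace.mk' (EuclideanSpace ℝ (Fin 4)) (D.jA ⟨G (x, 0), hGc _ (h0 x)⟩)
        (mfderiv (𝓡∂ 4) (𝓡∂ 4) D.jA ⟨G (x, 0), hGc _ (h0 x)⟩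
          (mfderiv 𝓘(ℝ, ℝ) (𝓡∂ 4) (fun ε : ℝ => G (x, ε)) 0 (1 : ℝ))) := by
    intro p hp e L eL
    subst e; subst eL; rfl
  exact key (G' (x, 0)) (hG'c _) hpt _ hv

end Family


/-! ### §2 Stage (3a): the end framing of the slide is homotopic to the one-twist fibre framing -/

section SlideEnd

variable {ι : Type*} [Finite ι] {M : Type*} [TopologicalSpace M] [T2Space M]
  [ChartedSpace (EuclideanHalfSpace 4) M] [IsManifold (𝓡∂ 4) ∞ M] {h : ι → HandleAttachingMap 3 2 M}
  {P : Type*} [TopologicalSpace P] [T2Space P] [ChartedSpace (EuclideanHalfSpace 4) P] [IsManifold (𝓡∂ 4) ∞ P]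
  (D : MultiAttachmentData h (𝓡∂ 4) P) (i : ι) (b : Bool)

omit [IsManifold (𝓡∂ 4) ∞ M] in
/-- Sphere points of the tube of handle `i` with non-zero fibre coordinate are off all cores. [folklore] -/
theorem apply_depthLine_mem_coresComplement (hd : Pairwise fun i j => Disjoint (range (h i).toFun) (range (h j).toFun))
    (ψ : sphere (0 : EuclideanSpace ℝ (Fin 2)) 1) {w : EuclideanSpace ℝ (Fin 2)} (hw : ‖w‖ < 1) (hw0 : w ≠ 0) :
    (h i).toFun (depthLine ψ w 0) ∈ coresComplement h := by
  refine BeltPageClause.apply_mem_coresComplement_of_lamSq_ne_one hd i _ ?_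
  have hpos : 0 < 1 - 0 - ‖w‖ ^ 2 := by nlinarith [norm_nonneg w]
  change lamSq 2 (tubeVec (depthLine ψ w 0)) ≠ 1
  rw [tubeVec_depthLine ψ w le_rfl hpos, lamSq_mkVec ψ w hpos.le]
  intro h1
  have : ‖w‖ ^ 2 = 0 := by linarith
  exact hw0 (norm_eq_zero.1 (pow_eq_zero_iff (n := 2) (by norm_num) |>.1 this))

omit [IsManifold (𝓡∂ 4) ∞ M] in
/-- The `r`-longitude of the attaching circle of handle `i` is off all cores (`0 < r < 1`). [folklore] -/
theorem longitude_mem_coresComplement (hd : Pairwise fun i j => Disjoint (range (h i).toFun) (range (h j).toFun))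
    {r : ℝ} (h0 : 0 < r) (h1 : r < 1) (θ : sphere (0 : EuclideanSpace ℝ (Fin 2)) 1) :
    (h i).toFun (tubeLongitudePt b r θ) ∈ coresComplement h :=
  BeltPageClause.apply_mem_coresComplement_of_lamSq_ne_one hd i _
    (lamSq_tubeLongitudePt_ne_one b h0.ne' (by nlinarith) θ)

omit [T2Space P] in
/-- **The one-twist fibre framing of the `r`-longitude, pushed to `∂P`, is continuous into `TP`.**
[folklore] -/
theorem continuous_jA_tubeFibreFraming_longitude {r : ℝ} (h0 : 0 < r) (h1 : r < 1) :
    Continuous fun θ : sphere (0 : EuclideanSpace ℝ (Fin 2)) 1 =>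
      (TotalSpace.mk' (EuclideanSpace ℝ (Fin 4))
        (D.jA ⟨(h i).toFun (tubeLongitudePt b r θ), longitude_mem_coresComplement i b D.disjoint h0 h1 θ⟩)
        (mfderiv (𝓡∂ 4) (𝓡∂ 4) D.jA
          ⟨(h i).toFun (tubeLongitudePt b r θ), longitude_mem_coresComplement i b D.disjoint h0 h1 θ⟩
          (tubeFibreFraming (h i) (uDir b θ) (r • (θ : EuclideanSpace ℝ (Fin 2))) (sqDir θ))) :
        TangentBundle (𝓡∂ 4) P) := by
  haveI := Fact.mk (@finrank_euclideanSpace_fin ℝ _ 2)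
  -- the fibre coordinate `w (θ, ε) = r θ + ε θ²`, the family `G = h̄ᵢ (depthLine (uDir b θ) w 0)` and its good set
  have hθc : ContMDiff ((𝓡 1).prod 𝓘(ℝ, ℝ)) 𝓘(ℝ, EuclideanSpace ℝ (Fin 2)) ∞
      fun q : (sphere (0 : EuclideanSpace ℝ (Fin 2)) 1) × ℝ => (q.1 : EuclideanSpace ℝ (Fin 2)) :=
    contMDiff_coe_sphere.comp contMDiff_fst
  have hεc : ContMDiff ((𝓡 1).prod 𝓘(ℝ, ℝ)) 𝓘(ℝ, ℝ) ∞
      fun q : (sphere (0 : EuclideanSpace ℝ (Fin 2)) 1) × ℝ => q.2 := contMDiff_snd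
  have hsq : ContMDiff ((𝓡 1).prod 𝓘(ℝ, ℝ)) 𝓘(ℝ, EuclideanSpace ℝ (Fin 2)) ∞
      fun q : (sphere (0 : EuclideanSpace ℝ (Fin 2)) 1) × ℝ => sqDir q.1 := contMDiff_sqDir.comp contMDiff_fst
  have hwc : ContMDiff ((𝓡 1).prod 𝓘(ℝ, ℝ)) 𝓘(ℝ, EuclideanSpace ℝ (Fin 2)) ∞
      fun q : (sphere (0 : EuclideanSpace ℝ (Fin 2)) 1) × ℝ =>
        r • (q.1 : EuclideanSpace ℝ (Fin 2)) + q.2 • sqDir q.1 :=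
    by
      have hrc : ContMDiff ((𝓡 1).prod 𝓘(ℝ, ℝ)) 𝓘(ℝ, ℝ) ∞
          fun _ : (sphere (0 : EuclideanSpace ℝ (Fin 2)) 1) × ℝ => r := contMDiff_const
      exact (hrc.smul hθc).add (hεc.smul hsq)
  have hO : IsOpen {q : (sphere (0 : EuclideanSpace ℝ (Fin 2)) 1) × ℝ |
      ‖r • (q.1 : EuclideanSpace ℝ (Fin 2)) + q.2 • sqDir q.1‖ < 1 ∧
        r • (q.1 : EuclideanSpace ℝ (Fin 2)) + q.2 • sqDir q.1 ≠ 0} :=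
    (isOpen_lt hwc.continuous.norm continuous_const).inter (isOpen_ne_fun hwc.continuous continuous_const)
  have hw0 : ∀ θ : sphere (0 : EuclideanSpace ℝ (Fin 2)) 1,
      r • (θ : EuclideanSpace ℝ (Fin 2)) + (0 : ℝ) • sqDir θ = r • (θ : EuclideanSpace ℝ (Fin 2)) := fun θ => by
    simp
  have hmem0 : ∀ θ : sphere (0 : EuclideanSpace ℝ (Fin 2)) 1,
      ((θ, (0 : ℝ)) : (sphere (0 : EuclideanSpace ℝ (Fin 2)) 1) × ℝ) ∈
        {q : (sphere (0 : EuclideanSpace ℝ (Fin 2)) 1) × ℝ |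
          ‖r • (q.1 : EuclideanSpace ℝ (Fin 2)) + q.2 • sqDir q.1‖ < 1 ∧
            r • (q.1 : EuclideanSpace ℝ (Fin 2)) + q.2 • sqDir q.1 ≠ 0} := by
    intro θ
    refine ⟨?_, ?_⟩
    · show ‖r • (θ : EuclideanSpace ℝ (Fin 2)) + (0 : ℝ) • sqDir θ‖ < 1
      rw [hw0, norm_smul_coe_sphere' h0.le]; exact h1
    · show r • (θ : EuclideanSpace ℝ (Fin 2)) + (0 : ℝ) • sqDir θ ≠ 0
      rw [hw0]; intro he
      have := congrArg norm he
      rw [norm_smul_coe_sphere' h0.le, norm_zero] at this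
      exact h0.ne' this
  have hGs : ContMDiffOn ((𝓡 1).prod 𝓘(ℝ, ℝ)) (𝓡∂ 4) ∞
      (fun q : (sphere (0 : EuclideanSpace ℝ (Fin 2)) 1) × ℝ =>
        (h i).toFun (depthLine (uDir b q.1) (r • (q.1 : EuclideanSpace ℝ (Fin 2)) + q.2 • sqDir q.1) 0))
      {q : (sphere (0 : EuclideanSpace ℝ (Fin 2)) 1) × ℝ |
        ‖r • (q.1 : EuclideanSpace ℝ (Fin 2)) + q.2 • sqDir q.1‖ < 1 ∧
          r • (q.1 : EuclideanSpace ℝ (Fin 2)) + q.2 • sqDir q.1 ≠ 0} := by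
    have hq : ContMDiff ((𝓡 1).prod 𝓘(ℝ, ℝ)) ((𝓡 1).prod 𝓘(ℝ, EuclideanSpace ℝ (Fin 2))) ∞
        fun q : (sphere (0 : EuclideanSpace ℝ (Fin 2)) 1) × ℝ =>
          ((uDir b q.1, r • (q.1 : EuclideanSpace ℝ (Fin 2)) + q.2 • sqDir q.1) :
            (sphere (0 : EuclideanSpace ℝ (Fin 2)) 1) × EuclideanSpace ℝ (Fin 2)) :=
      ((contMDiff_uDir b).comp contMDiff_fst).prodMk hwc
    have hmaps : MapsTo (fun q : (sphere (0 : EuclideanSpace ℝ (Fin 2)) 1) × ℝ =>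
          ((uDir b q.1, r • (q.1 : EuclideanSpace ℝ (Fin 2)) + q.2 • sqDir q.1) :
            (sphere (0 : EuclideanSpace ℝ (Fin 2)) 1) × EuclideanSpace ℝ (Fin 2)))
        {q : (sphere (0 : EuclideanSpace ℝ (Fin 2)) 1) × ℝ |
          ‖r • (q.1 : EuclideanSpace ℝ (Fin 2)) + q.2 • sqDir q.1‖ < 1 ∧
            r • (q.1 : EuclideanSpace ℝ (Fin 2)) + q.2 • sqDir q.1 ≠ 0}
        ((univ : Set (sphere (0 : EuclideanSpace ℝ (Fin 2)) 1)) ×ˢ ball (0 : EuclideanSpace ℝ (Fin 2)) 1) :=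
      fun q hq' => ⟨mem_univ _, by simpa using hq'.1⟩
    have hcomp := (contMDiffOn_sphereTubeMap (h i)).comp hq.contMDiffOn hmaps
    exact hcomp
  have hGc : ∀ q ∈ {q : (sphere (0 : EuclideanSpace ℝ (Fin 2)) 1) × ℝ |
      ‖r • (q.1 : EuclideanSpace ℝ (Fin 2)) + q.2 • sqDir q.1‖ < 1 ∧
        r • (q.1 : EuclideanSpace ℝ (Fin 2)) + q.2 • sqDir q.1 ≠ 0},
      (h i).toFun (depthLine (uDir b q.1) (r • (q.1 : EuclideanSpace ℝ (Fin 2)) + q.2 • sqDir q.1) 0) ∈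
        coresComplement h := fun q hq =>
    apply_depthLine_mem_coresComplement i D.disjoint (uDir b q.1) hq.1 hq.2
  have hc := continuous_mk_mfderiv_jA_family_of_mem D
    (fun q : (sphere (0 : EuclideanSpace ℝ (Fin 2)) 1) × ℝ =>
      (h i).toFun (depthLine (uDir b q.1) (r • (q.1 : EuclideanSpace ℝ (Fin 2)) + q.2 • sqDir q.1) 0))
    hO hmem0 hGs hGc
  refine hc.congr fun θ => ?_
  -- identify base point and vector
  have hpt : (h i).toFun (depthLine (uDir b θ) (r • (θ : EuclideanSpace ℝ (Fin 2)) + (0 : ℝ) • sqDir θ) 0) =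
      (h i).toFun (tubeLongitudePt b r θ) := by
    rw [hw0, depthLine_uDir_smul b h0.le h1 θ]
  have key : ∀ (p : M) (hp : p ∈ coresComplement h) (_ : p = (h i).toFun (tubeLongitudePt b r θ))
      (v : EuclideanSpace ℝ (Fin 4)),
      (TotalSpace.mk' (EuclideanSpace ℝ (Fin 4)) (D.jA ⟨p, hp⟩) (mfderiv (𝓡∂ 4) (𝓡∂ 4) D.jA ⟨p, hp⟩ v) :
        TangentBundle (𝓡∂ 4) P) =
      TotalSpace.mk' (EuclideanSpace ℝ (Fin 4))
        (D.jA ⟨(h i).toFun (tubeLongitudePt b r θ), longitude_mem_coresComplement i b D.disjoint h0 h1 θ⟩)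
        (mfderiv (𝓡∂ 4) (𝓡∂ 4) D.jA
          ⟨(h i).toFun (tubeLongitudePt b r θ), longitude_mem_coresComplement i b D.disjoint h0 h1 θ⟩ v) := by
    intro p hp e v; subst e; rfl
  exact key _ (hGc _ (hmem0 θ)) hpt _

/-- **Stage (3a) — the end framing of the belt-circle slide is homotopic, as a framing of the pushed
`r`-longitude `θ ↦ jA (h̄ᵢ (y θ))` in `∂P`, to the push-forward of the one-twist fibre framing**
`d(jA) (d/dε|₀ h̄ᵢ (depthLine (uDir b θ) (r θ + ε θ²) 0))` (`0 < r ≤ 1/2`): both are `d(jA) dh̄ᵢ Dι⁻¹` of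
`W` resp. `X_{θ²}`, and `W ≡ c θ₀ X_θ + (θ₁/c) X_{iθ}`, `X_{θ²} = θ₀ X_θ + θ₁ X_{iθ}` modulo the velocity,
so the segment between them is a homotopy of framings. [cite: Kirby1989, Ch. I §2] -/
theorem framingHomotopic_slideEnd_fibre {r : ℝ} (h0 : 0 < r) (h1 : r ≤ 1 / 2) :
    FramingHomotopic
      (fun θ => D.jA ⟨(h i).toFun (tubeLongitudePt b r θ), longitude_mem_coresComplement i b D.disjoint h0 (by linarith) θ⟩)
      (fun θ => mfderiv (𝓡∂ 4) (𝓡∂ 4) (fun a : ↥(coresComplement h) => D.jA a)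
        ⟨(h i).toFun (tubeLongitudePt b r θ), longitude_mem_coresComplement i b D.disjoint h0 (by linarith) θ⟩
        (mfderiv (𝓡∂ 4) (𝓡∂ 4) (h i).toFun (tubeLongitudePt b r θ)
          ((closedBallCoeDeriv ((tubeLongitudePt b r θ : ↥(handleTube 3 2)) :
            closedBall (0 : EuclideanSpace ℝ (Fin 4)) 1)).symm
            (WithLp.toLp 2 (frameW (slideSign b) r ((θ : EuclideanSpace ℝ (Fin 2)) 0) ((θ : EuclideanSpace ℝ (Fin 2)) 1))))))
      (fun θ => mfderiv (𝓡∂ 4) (𝓡∂ 4) (fun a : ↥(coresComplement h) => D.jA a)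
        ⟨(h i).toFun (tubeLongitudePt b r θ), longitude_mem_coresComplement i b D.disjoint h0 (by linarith) θ⟩
        (tubeFibreFraming (h i) (uDir b θ) (r • (θ : EuclideanSpace ℝ (Fin 2))) (sqDir θ))) := by
  have hr1 : r < 1 := by linarith
  set KM : sphere (0 : EuclideanSpace ℝ (Fin 2)) 1 → M := fun θ => (h i).toFun (tubeLongitudePt b r θ) with hKM_def
  have hmem : ∀ θ, KM θ ∈ coresComplement h := fun θ => longitude_mem_coresComplement i b D.disjoint h0 hr1 θ
  have hKM : IsBoundaryKnot KM := isBoundaryKnot_longitude (h i) b h0.le hr1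
  have hK : IsBoundaryKnot fun θ => D.jA ⟨KM θ, hmem θ⟩ := isBoundaryKnot_jA_comp D hKM hmem
  -- the start framing is the handle framing of the slid belt map at time `1`
  set q := slideMap D i b r 1 with hq_def
  have eK : ∀ θ, q.attachingCircle θ = D.jA ⟨KM θ, hmem θ⟩ := fun θ => attachingCircle_slideMap_one D i b h0 h1 θ
  have eν := fun θ => attachingFraming_slideMap_one_eq_mfderiv D i b h0 h1 θ
  have hfr := isKnotFraming_attachingFraming q
  refine framingHomotopic_of_segment hK ?_ ?_ ?_ ?_ ?_
  · refine hfr.continuous.congr fun θ => ?_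
    exact tangentBundle_mk_eq (eK θ) (eν θ)
  · exact continuous_jA_tubeFibreFraming_longitude D i b h0 hr1
  · intro u
    rw [← eν u]; exact hfr.mem_boundaryTangentSpace u
  · intro u
    have hb : (𝓡∂ 4).IsBoundaryPoint (KM u) := hKM.isBoundaryPoint u
    exact mfderiv_jA_mem_boundaryTangentSpace D ⟨KM u, hmem u⟩ hb
      (tubeFibreFraming_mem_boundaryTangentSpace (h i) (uDir b u)
        (by rw [norm_smul_coe_sphere' h0.le]; exact hr1) (sqDir u))
  · -- transversality along the segment, read in `ℝ⁴` through the injective `L = d(jA) ∘ dh̄ᵢ ∘ Dι⁻¹`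
    intro s hs t
    set θ : sphere (0 : EuclideanSpace ℝ (Fin 2)) 1 := circlePt t with hθ_def
    set pt : ↥(handleTube 3 2) := tubeLongitudePt b r θ with hpt_def
    set a : ↥(coresComplement h) := ⟨KM θ, hmem θ⟩ with ha_def
    set Dι := closedBallCoeDeriv ((pt : ↥(handleTube 3 2)) : closedBall (0 : EuclideanSpace ℝ (Fin 4)) 1) with hDι
    have Lf_def : ∃ Lf : EuclideanSpace ℝ (Fin 4) →L[ℝ] EuclideanSpace ℝ (Fin 4),
        ∀ x, Lf x = mfderiv (𝓡∂ 4) (𝓡∂ 4) D.jA a (mfderiv (𝓡∂ 4) (𝓡∂ 4) (h i).toFun pt (Dι.symm x)) :=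
      ⟨((mfderiv (𝓡∂ 4) (𝓡∂ 4) D.jA a).comp (mfderiv (𝓡∂ 4) (𝓡∂ 4) (h i).toFun pt)).comp
        (Dι.symm : EuclideanSpace ℝ (Fin 4) →L[ℝ] EuclideanSpace ℝ (Fin 4)), fun x => rfl⟩
    obtain ⟨Lf, hLf⟩ := Lf_def
    have hθsq : (θ : EuclideanSpace ℝ (Fin 2)) 0 ^ 2 + (θ : EuclideanSpace ℝ (Fin 2)) 1 ^ 2 = 1 := by
      have h2 : ‖(θ : EuclideanSpace ℝ (Fin 2))‖ ^ 2 = 1 := by rw [norm_eq_of_mem_sphere θ, one_pow]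
      rwa [EuclideanSpace.real_norm_sq_eq, Fin.sum_univ_two] at h2
    -- abbreviate the three model vectors
    set W' : EuclideanSpace ℝ (Fin 4) := WithLp.toLp 2 (frameW (slideSign b) r
      ((θ : EuclideanSpace ℝ (Fin 2)) 0) ((θ : EuclideanSpace ℝ (Fin 2)) 1)) with hW'
    set X' : EuclideanSpace ℝ (Fin 4) := WithLp.toLp 2 (twistVec (slideSign b) r
      ((θ : EuclideanSpace ℝ (Fin 2)) 0) ((θ : EuclideanSpace ℝ (Fin 2)) 1)) with hX'
    set V' : EuclideanSpace ℝ (Fin 4) := WithLp.toLp 2 (longVelVec (slideSign b) r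
      ((θ : EuclideanSpace ℝ (Fin 2)) 0) ((θ : EuclideanSpace ℝ (Fin 2)) 1)) with hV'
    -- the three vectors as images of `Lf`
    have hvel : knotVelocity (fun θ => D.jA ⟨KM θ, hmem θ⟩) t = Lf ((2 * Real.pi) • V') := by
      rw [hLf, knotVelocity_jA_comp D hKM.isSmoothEmbedding.contMDiff hmem t, knotVelocity_longitude (h i) b h0.le hr1 t]
    have hν : mfderiv (𝓡∂ 4) (𝓡∂ 4) (fun a : ↥(coresComplement h) => D.jA a)
        ⟨(h i).toFun (tubeLongitudePt b r θ), longitude_mem_coresComplement i b D.disjoint h0 hr1 θ⟩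
        (mfderiv (𝓡∂ 4) (𝓡∂ 4) (h i).toFun (tubeLongitudePt b r θ)
          ((closedBallCoeDeriv ((tubeLongitudePt b r θ : ↥(handleTube 3 2)) :
            closedBall (0 : EuclideanSpace ℝ (Fin 4)) 1)).symm W')) = Lf W' := by
      rw [hLf]
    have hν' : mfderiv (𝓡∂ 4) (𝓡∂ 4) (fun a : ↥(coresComplement h) => D.jA a)
        ⟨(h i).toFun (tubeLongitudePt b r θ), longitude_mem_coresComplement i b D.disjoint h0 hr1 θ⟩
        (tubeFibreFraming (h i) (uDir b θ) (r • (θ : EuclideanSpace ℝ (Fin 2))) (sqDir θ)) = Lf X' := by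
      rw [hLf, tubeFibreFraming_eq_mfderiv (h i) (uDir b θ) (by rw [norm_smul_coe_sphere' h0.le]; exact hr1) (sqDir θ),
        fibreVec_longitude b h0.le θ]
      have key : ∀ (y : ↥(handleTube 3 2)) (_ : y = pt) (X : EuclideanSpace ℝ (Fin 4)),
          mfderiv (𝓡∂ 4) (𝓡∂ 4) (h i).toFun y ((closedBallCoeDeriv ((y : ↥(handleTube 3 2)) :
            closedBall (0 : EuclideanSpace ℝ (Fin 4)) 1)).symm X) =
          mfderiv (𝓡∂ 4) (𝓡∂ 4) (h i).toFun pt (Dι.symm X) := by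
        intro y e X; subst e; rfl
      exact congrArg (mfderiv (𝓡∂ 4) (𝓡∂ 4) D.jA a) (key _ (depthLine_uDir_smul b h0.le hr1 θ) _)
    have hLinj : Injective Lf := fun x y hxy => by
      rw [hLf, hLf] at hxy
      exact Dι.symm.injective (injective_mfderiv_handleAttachingMap (h i) pt (injective_mfderiv_jA D a hxy))
    rw [Submodule.mem_span_singleton, hvel]
    rintro ⟨μ, hμ⟩
    rw [hν, hν'] at hμ
    have e1 : Lf ((1 - s) • W' + s • X') = (1 - s) • Lf W' + s • Lf X' := by
      rw [map_add, map_smul, map_smul]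
    have e2 : Lf ((μ * (2 * Real.pi)) • V') = μ • Lf ((2 * Real.pi) • V') := by
      rw [map_smul, map_smul, smul_smul]
    have heq := hLinj (e2.trans (hμ.trans e1.symm))
    have heq' := congrArg (WithLp.ofLp) heq
    simp only [hW', hX', hV', WithLp.ofLp_add, WithLp.ofLp_smul] at heq'
    exact segment_frameW_twistVec_ne (slideSign_sq b) h0 hr1 hθsq hs (μ * (2 * Real.pi)) heq'.symm

end SlideEnd


/-! ### §3 Registered helper -/

/-- **Registered helper `helper_belt_slideFraming_homotopic` (node T3c-1 of NF6 `stub_steinRealisation`,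
stage (3a) "framing clean-up", wave 3, lead c5).**  For multi-attachment data `D` of 2-handles `h`, a
handle `i`, a direction flag `b` and a radius `0 < r ≤ 1/2`: the end framing
`θ ↦ d(jA) (dh̄ᵢ (Dι⁻¹ W(θ)))` of the belt-circle slide (`helper_belt_slide`, `helper_belt_slideFramingVector`)
of the pushed `r`-longitude `θ ↦ jA (h̄ᵢ (tubeLongitudePt b r θ))` is homotopic through framings
(`FramingHomotopic`) to the push-forward `d(jA)` of the one-twist fibre framing: the velocity at `ε = 0` of
`ε ↦ h̄ᵢ (depthLine (uDir b θ) (r θ + ε θ²) 0)`, `uDir b θ = (θ₀, ∓θ₁)`, `θ² = (θ₀² − θ₁², 2 θ₀ θ₁)`.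
[cite: Kirby1989, Ch. I §2] -/
theorem helper_belt_slideFraming_homotopic :
    ∀ {ι : Type} [Finite ι] {M : Type} [TopologicalSpace M] [T2Space M] [ChartedSpace (EuclideanHalfSpace 4) M]
      [IsManifold (𝓡∂ 4) ∞ M] {h : ι → Literature.Topology.FourManifolds.HandleAttachingMap 3 2 M}
      {P : Type} [TopologicalSpace P] [T2Space P] [ChartedSpace (EuclideanHalfSpace 4) P] [IsManifold (𝓡∂ 4) ∞ P]
      (D : Literature.Topology.FourManifolds.HandleAttachingMap.MultiAttachmentData h (𝓡∂ 4) P)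
      (i : ι) (b : Bool) (r : ℝ) (_ : 0 < r) (_ : r ≤ 1 / 2)
      (hmem : ∀ θ : Metric.sphere (0 : EuclideanSpace ℝ (Fin 2)) 1, (h i).toFun
        (Summit.SmoothPoincare4.SmoothPoincare4.Theorems.AcyclicBisectionExists.ModpBraidOrbits.tubeLongitudePt b r θ) ∈
          Literature.Topology.FourManifolds.HandleAttachingMap.coresComplement h),
      Literature.Geometry.Symplectic.FramingHomotopic
        (fun θ => D.jA ⟨(h i).toFun
          (Summit.SmoothPoincare4.SmoothPoincare4.Theorems.AcyclicBisectionExists.ModpBraidOrbits.tubeLongitudePt b r θ), hmem θ⟩)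
        (fun θ => mfderiv (𝓡∂ 4) (𝓡∂ 4)
          (fun a : ↥(Literature.Topology.FourManifolds.HandleAttachingMap.coresComplement h) => D.jA a)
          ⟨(h i).toFun
            (Summit.SmoothPoincare4.SmoothPoincare4.Theorems.AcyclicBisectionExists.ModpBraidOrbits.tubeLongitudePt b r θ), hmem θ⟩
          (mfderiv (𝓡∂ 4) (𝓡∂ 4) (h i).toFun
            (Summit.SmoothPoincare4.SmoothPoincare4.Theorems.AcyclicBisectionExists.ModpBraidOrbits.tubeLongitudePt b r θ)
            ((Literature.Topology.FourManifolds.closedBallCoeDeriv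
              ((Summit.SmoothPoincare4.SmoothPoincare4.Theorems.AcyclicBisectionExists.ModpBraidOrbits.tubeLongitudePt b r θ :
                ↥(Literature.Topology.FourManifolds.handleTube 3 2)) : Metric.closedBall (0 : EuclideanSpace ℝ (Fin 4)) 1)).symm
              (WithLp.toLp 2 (Summit.SmoothPoincare4.SmoothPoincare4.Theorems.AcyclicBisectionExists.ModpBraidOrbits.frameW
                (Summit.SmoothPoincare4.SmoothPoincare4.Theorems.AcyclicBisectionExists.ModpBraidOrbits.slideSign b) r
                ((θ : EuclideanSpace ℝ (Fin 2)) 0) ((θ : EuclideanSpace ℝ (Fin 2)) 1))))))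
        (fun θ => mfderiv (𝓡∂ 4) (𝓡∂ 4)
          (fun a : ↥(Literature.Topology.FourManifolds.HandleAttachingMap.coresComplement h) => D.jA a)
          ⟨(h i).toFun
            (Summit.SmoothPoincare4.SmoothPoincare4.Theorems.AcyclicBisectionExists.ModpBraidOrbits.tubeLongitudePt b r θ), hmem θ⟩
          (mfderiv 𝓘(ℝ, ℝ) (𝓡∂ 4) (fun ε : ℝ => (h i).toFun (Literature.Topology.FourManifolds.depthLine
            (Summit.SmoothPoincare4.SmoothPoincare4.Theorems.AcyclicBisectionExists.ModpBraidOrbits.uDir b θ)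
            (r • (θ : EuclideanSpace ℝ (Fin 2)) +
              ε • Summit.SmoothPoincare4.SmoothPoincare4.Theorems.AcyclicBisectionExists.ModpBraidOrbits.sqDir θ) 0)) 0 (1 : ℝ))) := by
  intro ι _ M _ _ _ _ h P _ _ _ _ D i b r h0 h1 hmem
  exact framingHomotopic_slideEnd_fibre D i b h0 h1

end Summit.SmoothPoincare4.SmoothPoincare4.Theorems.AcyclicBisectionExists.ModpBraidOrbits

end
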